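import Literature.AlgebraicGeometry.Motives.MumfordTateGroupRealPointsPolarFactorisation
import Mathlib.Algebra.Ring.Subring.Units
import HarnessLib

/-!
# `MT(H)(ℝ) ≅ ℝ^×_{>0} × Hg(H)(ℝ)` for EVERY Hodge structure of CM type and odd weight, `MT(H)(ℝ) ∩ Z(C) ≅ ℝ^×_{>0} × (Hg(H)(ℝ) ∩ Z(C))`
# for every polarizable one, and the exact sequence `1 → Hg(H)(L) → MT(H)(L) → ν(MT(H)(L)) → 1` on points with
# `ν(MT(H)(ℝ)) = ℝ^×_{>0}` or `ℝ^×` (Green–Griffiths–Kerr §I.B «`M_φ̃ = 𝔾_m · M_φ`»; Moonen (5.8); CMSP 15.2 Remark (ii))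

Family `hodge`, lane `lit-hodgefound` (Track 2 foundations library; Layers A2/A3), layer `Literature/AlgebraicGeometry/Motives`,
namespace `Literature.AlgebraicGeometry.Motives.HodgeStructure`.  THEOREMS ONLY (no definition, no named fact; D-0026 net debt
`0`).  The GENERAL forms of the tree's `Motives/MumfordTateGroupOfCMFamilyRealPointsProduct` (there: the CM algebra
`⊕ᵢ V¹_{(Kᵢ,Φᵢ)}` only, `MT(⊕)(ℝ) ≅ ℝ^×_{>0} × Hg(⊕)(ℝ)`), built on the seat's general polar factorisation
`Motives/MumfordTateGroupRealPointsPolarFactorisation`: (§1) for EVERY polarizable `H` of odd weight (`V ≠ 0`) the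
multiplication map `(t, γ₀) ↦ t · γ₀` is a group isomorphism `ℝ^×_{>0} × (Hg(H)(ℝ) ∩ Z(C_ℝ)) ≅ MT(H)(ℝ) ∩ Z(C_ℝ)` (the
almost-direct product «`M_φ̃ = 𝔾_m · M_φ`» is an honest direct product on the real points commuting with the Weil operator);
(§2) for `H` moreover OF CM TYPE (`Lie Hg ⊆ End_Hdg`, so `Z(C_ℝ) ⊇ MT(H)(ℝ)`): **`MT(H)(ℝ) ≅ ℝ^×_{>0} × Hg(H)(ℝ)`**;
(§3) the multiplier on points: `MT(H)(L) / Hg(H)(L) ≅ ν(MT(H)(L)) ≤ L^×` for every field `L ⊇ ℚ` (Moonen's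
`Hg = Ker(MT → 𝔾_m)`, the tree's `Polarization.hodgeGroupBaseChange_subgroupOf_eq_ker_multiplierChar`, as a quotient
isomorphism), `ℝ^×_{>0} ≤ ν(MT(H)(ℝ))` (weight `≠ 0`: `ν(√t · id) = t`), hence the DICHOTOMY `ν(MT(H)(ℝ)) = ℝ^×_{>0}` or `= ℝ^×`,
and `= ℝ^×_{>0}` with **`MT(H)(ℝ)/Hg(H)(ℝ) ≅ ℝ^×_{>0}`** in the CM case; (§4) the CM algebra instances.

THE PRINTS.  M. Green, P. Griffiths, M. Kerr (2012) [GreenGriffithsKerr2012] §I.B before (I.B.1) «`M_φ̃` is the almost direct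
product `𝔾_m · M_φ`», §II.A (PDF p. 45) (the compact centralizer of the circle).  B. Moonen (2004) [Moonen2004MT] (5.8) «Define
the Hodge group … `Hg(X) := Ker(MT(X) ↪ CSp(V, φ) —ν→ 𝔾_m)`».  J. Carlson, S. Müller-Stach, C. Peters (2017)
[CarlsonMullerStachPeters2017] §15.2 Remark (ii) after Def. 15.2.1 «`MT(h) = SMT(h) · h∘w(𝐆_m)` … isogenous to `SMT(h) × G_m`»,
Examples 15.2.4 (i)–(ii).  P. Deligne (1982) [Deligne1982HodgeCycles] I proof of Prop. 3.6 (p0025), Example 3.7 (d) (the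
multiplier `e₀`), §5.  J. S. Milne, *Algebraic Groups* [Milne2017] Ch. 12 Exercise 12-7.

THE OBJECTS (all the tree's / Mathlib's).  `H : HodgeStructure V n`, `V ≠ 0` finite-dimensional; `MT(H)(L)`, `Hg(H)(L)` subgroups
of `GL(L ⊗ V)`; the real Weil operator `C_ℝ = H.realWeilOperator ∈ MT(H)(ℝ)` and its centralizer
`Z(C_ℝ) = Subgroup.centralizer {C_ℝ}`; a polarization `ψ` with multiplier `ν = ψ.multiplierChar L : MT(H)(L) →* L^×` and its
range `(ψ.multiplierChar L).range`; the positive units `ℝ^×_{>0} = Units.posSubgroup ℝ`; real homotheties `t · id = LinearEquiv.smulOfUnit t`;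
«CM type» = `H.hodgeLie ≤ Subalgebra.toSubmodule H.endAlg`.

WHAT IS PROVED.
* §0 `mem_centralizer_realWeilOperator_iff` (`γ ∈ Z(C_ℝ) ⟺ γ C_ℝ = C_ℝ γ` pointwise), `smulOfUnit_mem_centralizer_realWeilOperator`.
* §1 (polarizable, odd weight, `V ≠ 0`) **`nonempty_inf_centralizer_mulEquiv_posSubgroup_prod`** —
  `MT(H)(ℝ) ⊓ Z(C_ℝ) ≃* ℝ^×_{>0} × (Hg(H)(ℝ) ⊓ Z(C_ℝ))`.
* §2 (CM type, odd weight, polarizable, `V ≠ 0`) **`nonempty_mumfordTateGroupBaseChange_real_mulEquiv_posSubgroup_prod_of_hodgeLie_le`**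
  — **`MT(H)(ℝ) ≃* ℝ^×_{>0} × Hg(H)(ℝ)`**.
* §3 `Polarization.normal_hodgeGroupBaseChange_subgroupOf` (`Hg(L) ⊴ MT(L)`, odd weight),
  `Polarization.nonempty_quotient_hodgeGroupBaseChange_mulEquiv_range_multiplierChar` (`MT(L)/Hg(L) ≅ ν(MT(L))`, odd weight, any `L`),
  `Polarization.posSubgroup_le_range_multiplierChar_real` (weight `≠ 0`), **`Polarization.range_multiplierChar_real_eq_posSubgroup_or_eq_top`**,
  `Polarization.range_multiplierChar_real_eq_posSubgroup_iff`, **`Polarization.range_multiplierChar_real_eq_posSubgroup_of_hodgeLie_le`**,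
  **`nonempty_quotient_hodgeGroupBaseChange_real_mulEquiv_posSubgroup_of_hodgeLie_le`** (`MT(H)(ℝ)/Hg(H)(ℝ) ≅ ℝ^×_{>0}`).
* §4 (CM algebra) `Polarization.range_multiplierChar_real_ofCMFamily_eq_posSubgroup`,
  `nonempty_quotient_hodgeGroupBaseChange_real_ofCMFamily_mulEquiv_posSubgroup`, `normal_hodgeGroupBaseChange_real_ofCMFamily_subgroupOf`.

DEVIATIONS / NOTE.  The quotient statements carry the normality of `Hg(L)` in `MT(L)` as an INSTANCE HYPOTHESIS (no `instance` is
declared in Literature files); discharge it with `haveI := ψ.normal_hodgeGroupBaseChange_subgroupOf H L hn`.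

DEVIATIONS / SCOPE.  On points, Tannaka-free.  NOT HERE: even weight (`Ker ν ⊋ Hg`); `ν(MT(H)(ℝ)) = ℝ^×` examples (non-CM,
e.g. `GL₂`): the dichotomy is proved, which side occurs is decided here only under the CM / centralizer hypotheses.

## References
* [GreenGriffithsKerr2012] M. Green, P. A. Griffiths, M. Kerr, *Mumford–Tate Groups and Domains* (2012) — §I.B (before (I.B.1)), §II.A.
* [Moonen2004MT] B. Moonen, *An introduction to Mumford–Tate groups* (2004) — (5.8).
* [CarlsonMullerStachPeters2017] J. Carlson, S. Müller-Stach, C. Peters, *Period Mappings and Period Domains*, 2nd ed. (2017) —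
  §15.2 Remark (ii) after Def. 15.2.1, Examples 15.2.4.
* [Deligne1982HodgeCycles] P. Deligne, *Hodge cycles on abelian varieties*, in LNM 900 (1982) — I proof of Prop. 3.6, Example 3.7 (d), §5.
* [Milne2017] J. S. Milne, *Algebraic Groups*, CUP (2017) — Ch. 12 Exercise 12-7.

## Provenance
Lane `lit-hodgefound` (Hodge path, Track 2), prover seat `lit-hodgefound-p29` (generation 22), self-proposed row g22-#9 (general form
of `Motives/MumfordTateGroupOfCMFamilyRealPointsProduct` via g22-#3).
-/

noncomputable section

open scoped TensorProduct
open Module NumberField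

namespace Literature.AlgebraicGeometry.Motives

namespace HodgeStructure

open Literature.NumberTheory.ComplexMultiplication

universe u w

/-! ### §0 Scalars and the centralizer of the real Weil operator -/

section Scalars

variable {L : Type w} [Field L] {M : Type u} [AddCommGroup M] [Module L M]

/-- `smulOfUnit` is multiplicative. [folklore] -/
private theorem smulOfUnit_mul₁ (a b : Lˣ) :
    (LinearEquiv.smulOfUnit (a * b) : M ≃ₗ[L] M) = LinearEquiv.smulOfUnit a * LinearEquiv.smulOfUnit b :=
  map_mul (DistribMulAction.toModuleAut L M) a b

/-- Homotheties are central in `GL(M)`. [folklore] -/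
private theorem smulOfUnit_mul_comm₁ (a : Lˣ) (γ : M ≃ₗ[L] M) :
    LinearEquiv.smulOfUnit a * γ = γ * LinearEquiv.smulOfUnit a :=
  LinearEquiv.ext fun x => by
    change (a : L) • γ x = γ ((a : L) • x)
    rw [map_smul]

/-- `smulOfUnit 1 = 1`. [folklore] -/
private theorem smulOfUnit_one₁ : (LinearEquiv.smulOfUnit (1 : Lˣ) : M ≃ₗ[L] M) = 1 :=
  LinearEquiv.ext fun x => one_smul L x

/-- `a⁻¹ · (a · γ) = γ`. [folklore] -/
private theorem smulOfUnit_inv_mul_smulOfUnit_mul₁ (a : Lˣ) (γ : M ≃ₗ[L] M) :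
    LinearEquiv.smulOfUnit a⁻¹ * (LinearEquiv.smulOfUnit a * γ) = γ := by
  rw [← mul_assoc, ← smulOfUnit_mul₁, inv_mul_cancel, smulOfUnit_one₁, one_mul]

/-- `a · (a⁻¹ · γ) = γ`. [folklore] -/
private theorem smulOfUnit_mul_smulOfUnit_inv_mul₁ (a : Lˣ) (γ : M ≃ₗ[L] M) :
    LinearEquiv.smulOfUnit a * (LinearEquiv.smulOfUnit a⁻¹ * γ) = γ := by
  rw [← mul_assoc, ← smulOfUnit_mul₁, mul_inv_cancel, smulOfUnit_one₁, one_mul]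

/-- **The abstract direct-product criterion**: for subgroups `S ≤ T` of `GL(M)` over `ℝ` such that `T` contains the positive
homotheties and every `γ ∈ T` is `t · γ₀` with `t > 0` and `γ₀ ∈ S`, the scalar `t` being unique, the multiplication map
`(t, γ₀) ↦ t · γ₀` is an isomorphism `ℝ^×_{>0} × S ≅ T`. [folklore] -/
private theorem nonempty_mulEquiv_posSubgroup_prod {M : Type u} [AddCommGroup M] [Module ℝ M] (T S : Subgroup (M ≃ₗ[ℝ] M))
    (hST : S ≤ T) (hscal : ∀ t : ℝˣ, 0 < (t : ℝ) → LinearEquiv.smulOfUnit t ∈ T)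
    (hex : ∀ γ ∈ T, ∃ t : ℝˣ, 0 < (t : ℝ) ∧ LinearEquiv.smulOfUnit t⁻¹ * γ ∈ S)
    (huniq : ∀ γ ∈ T, ∀ t t' : ℝˣ, 0 < (t : ℝ) → 0 < (t' : ℝ) →
      LinearEquiv.smulOfUnit t⁻¹ * γ ∈ S → LinearEquiv.smulOfUnit t'⁻¹ * γ ∈ S → t = t') :
    Nonempty (T ≃* Units.posSubgroup ℝ × S) := by
  let f : Units.posSubgroup ℝ × S →* T :=
    { toFun := fun p => ⟨LinearEquiv.smulOfUnit (p.1 : ℝˣ) * (p.2 : M ≃ₗ[ℝ] M),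
        mul_mem (hscal _ ((Units.mem_posSubgroup _).1 p.1.2)) (hST p.2.2)⟩
      map_one' := Subtype.ext (by
        change LinearEquiv.smulOfUnit (1 : ℝˣ) * (1 : M ≃ₗ[ℝ] M) = 1
        rw [mul_one, smulOfUnit_one₁])
      map_mul' := fun p q => Subtype.ext (by
        change LinearEquiv.smulOfUnit ((p.1 : ℝˣ) * (q.1 : ℝˣ)) * ((p.2 : M ≃ₗ[ℝ] M) * (q.2 : M ≃ₗ[ℝ] M)) =
          LinearEquiv.smulOfUnit (p.1 : ℝˣ) * (p.2 : M ≃ₗ[ℝ] M) * (LinearEquiv.smulOfUnit (q.1 : ℝˣ) * (q.2 : M ≃ₗ[ℝ] M))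
        rw [smulOfUnit_mul₁, mul_assoc, mul_assoc, ← mul_assoc (LinearEquiv.smulOfUnit (q.1 : ℝˣ)),
          smulOfUnit_mul_comm₁ (q.1 : ℝˣ), mul_assoc]) }
  have hf : ∀ p, ((f p : T) : M ≃ₗ[ℝ] M) = LinearEquiv.smulOfUnit (p.1 : ℝˣ) * (p.2 : M ≃ₗ[ℝ] M) := fun _ => rfl
  refine ⟨(MulEquiv.ofBijective f ⟨?_, ?_⟩).symm⟩
  · rintro ⟨⟨t, ht⟩, γ, hγ⟩ ⟨⟨t', ht'⟩, γ', hγ'⟩ h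
    have hΓ := congrArg (fun g : T => (g : M ≃ₗ[ℝ] M)) h
    simp only [hf] at hΓ
    change LinearEquiv.smulOfUnit t * γ = LinearEquiv.smulOfUnit t' * γ' at hΓ
    have hT : LinearEquiv.smulOfUnit t * γ ∈ T := mul_mem (hscal _ ((Units.mem_posSubgroup _).1 ht)) (hST hγ)
    have h1 : LinearEquiv.smulOfUnit t⁻¹ * (LinearEquiv.smulOfUnit t * γ) ∈ S := by
      rw [smulOfUnit_inv_mul_smulOfUnit_mul₁]; exact hγ
    have h2 : LinearEquiv.smulOfUnit t'⁻¹ * (LinearEquiv.smulOfUnit t * γ) ∈ S := by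
      rw [hΓ, smulOfUnit_inv_mul_smulOfUnit_mul₁]; exact hγ'
    have htt : t = t' := huniq _ hT t t' ((Units.mem_posSubgroup t).1 ht) ((Units.mem_posSubgroup t').1 ht') h1 h2
    subst htt
    have hγγ : γ = γ' := by
      rw [← smulOfUnit_inv_mul_smulOfUnit_mul₁ t γ, hΓ, smulOfUnit_inv_mul_smulOfUnit_mul₁]
    subst hγγ
    rfl
  · rintro ⟨Γ, hΓ⟩
    obtain ⟨t, ht, hmem⟩ := hex Γ hΓ
    refine ⟨⟨⟨t, (Units.mem_posSubgroup t).2 ht⟩, ⟨_, hmem⟩⟩, Subtype.ext ?_⟩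
    rw [hf]
    exact smulOfUnit_mul_smulOfUnit_inv_mul₁ t Γ

/-- A subgroup of `ℝ^×` containing the positive units is `ℝ^×_{>0}` or all of `ℝ^×` (`ℝ^×_{>0}` has index two). [folklore] -/
private theorem eq_posSubgroup_or_eq_top_of_le {S : Subgroup ℝˣ} (hS : Units.posSubgroup ℝ ≤ S) :
    S = Units.posSubgroup ℝ ∨ S = ⊤ := by
  by_cases h : ∃ u ∈ S, (u : ℝ) < 0
  · obtain ⟨u, huS, hu⟩ := h
    refine Or.inr (eq_top_iff.2 fun v _ => ?_)
    rcases lt_or_gt_of_ne v.ne_zero with hv | hv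
    · have hq : 0 < ((v * u⁻¹ : ℝˣ) : ℝ) := by
        rw [Units.val_mul, Units.val_inv_eq_inv_val]
        exact mul_pos_of_neg_of_neg hv (inv_lt_zero.2 hu)
      have := mul_mem (hS ((Units.mem_posSubgroup _).2 hq)) huS
      rwa [inv_mul_cancel_right] at this
    · exact hS ((Units.mem_posSubgroup _).2 hv)
  · push Not at h
    refine Or.inl (le_antisymm (fun u hu => (Units.mem_posSubgroup _).2 ?_) hS)
    exact lt_of_le_of_ne (h u hu) (Ne.symm u.ne_zero)

end Scalars

section General

variable {V : Type u} [AddCommGroup V] [Module ℚ V] {n : ℤ} (H : HodgeStructure V n)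

/-- `γ ∈ Z(C_ℝ)` (Mathlib's `Subgroup.centralizer {C_ℝ}` in `GL(V_ℝ)`) iff `γ C_ℝ = C_ℝ γ` pointwise.
[cite: GreenGriffithsKerr2012, §II.A (PDF p. 45)] -/
theorem mem_centralizer_realWeilOperator_iff (γ : (ℝ ⊗[ℚ] V) ≃ₗ[ℝ] (ℝ ⊗[ℚ] V)) :
    γ ∈ Subgroup.centralizer ({H.realWeilOperator} : Set ((ℝ ⊗[ℚ] V) ≃ₗ[ℝ] (ℝ ⊗[ℚ] V))) ↔
      ∀ a : ℝ ⊗[ℚ] V, γ (H.realWeilOperator a) = H.realWeilOperator (γ a) := by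
  rw [Subgroup.mem_centralizer_iff]
  simp only [Set.mem_singleton_iff, forall_eq]
  constructor
  · intro h a
    exact (LinearEquiv.congr_fun h a).symm
  · intro h
    exact LinearEquiv.ext fun a => (h a).symm

/-- Real homotheties commute with `C_ℝ`. [cite: GreenGriffithsKerr2012, §I.B (semi-direct product remark before (I.B.1))] -/
theorem smulOfUnit_mem_centralizer_realWeilOperator (t : ℝˣ) :
    LinearEquiv.smulOfUnit t ∈ Subgroup.centralizer ({H.realWeilOperator} : Set ((ℝ ⊗[ℚ] V) ≃ₗ[ℝ] (ℝ ⊗[ℚ] V))) := by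
  rw [mem_centralizer_realWeilOperator_iff]
  intro a
  change (t : ℝ) • H.realWeilOperator a = H.realWeilOperator ((t : ℝ) • a)
  rw [map_smul]

variable [Module.Finite ℚ V] [HodgeTensorFacts.{u, u}]

/-! ### §1 Every polarizable `H` of odd weight: `MT(H)(ℝ) ∩ Z(C_ℝ) ≅ ℝ^×_{>0} × (Hg(H)(ℝ) ∩ Z(C_ℝ))` -/

/-- **`MT(H)(ℝ) ∩ Z(C_ℝ) ≅ ℝ^×_{>0} × (Hg(H)(ℝ) ∩ Z(C_ℝ))`** for every polarizable `H` of odd weight (`V ≠ 0`): on the real points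
commuting with the Weil operator the almost-direct product «`M_φ̃ = 𝔾_m · M_φ`» is a direct product of the positive homotheties
and the `B_ψ`-isometries, via `(t, γ₀) ↦ t · γ₀` (existence and uniqueness of the polar factorisation:
`exists_pos_smulOfUnit_mul_mem_hodgeGroupBaseChange_real_of_comm`, `Polarization.eq_of_smulOfUnit_mul_mem_hodgeGroupBaseChange_real`).
[cite: GreenGriffithsKerr2012, §I.B (semi-direct product remark before (I.B.1)) and §II.A (PDF p. 45)]
[cite: CarlsonMullerStachPeters2017, §15.2 Remark (ii) after Definition 15.2.1] [cite: Deligne1982HodgeCycles, I §3 proof of Prop. 3.6 (p. 25)] -/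
theorem nonempty_inf_centralizer_mulEquiv_posSubgroup_prod [Nontrivial V] (hn : Odd n) (hH : H.IsPolarizable) :
    Nonempty (↥(H.mumfordTateGroupBaseChange ℝ ⊓ Subgroup.centralizer {H.realWeilOperator}) ≃*
      Units.posSubgroup ℝ × ↥(H.hodgeGroupBaseChange ℝ ⊓ Subgroup.centralizer {H.realWeilOperator})) := by
  have hn0 : n ≠ 0 := by
    rintro rfl
    exact (by decide : ¬ Odd (0 : ℤ)) hn
  obtain ⟨ψ⟩ := hH
  refine nonempty_mulEquiv_posSubgroup_prod _ _
    (inf_le_inf_right _ (hodgeGroupBaseChange_le_mumfordTateGroupBaseChange ℝ H)) (fun t _ => ?_) (fun γ hγ => ?_)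
    (fun γ _ t t' ht ht' h h' => ψ.eq_of_smulOfUnit_mul_mem_hodgeGroupBaseChange_real H ht ht'
      (Subgroup.mem_inf.1 h).1 (Subgroup.mem_inf.1 h').1)
  · exact Subgroup.mem_inf.2 ⟨H.smulOfUnit_mem_mumfordTateGroupBaseChange ℝ hn0 t, smulOfUnit_mem_centralizer_realWeilOperator H t⟩
  · obtain ⟨hγ, hC⟩ := Subgroup.mem_inf.1 hγ
    obtain ⟨t, ht, hmem⟩ := exists_pos_smulOfUnit_mul_mem_hodgeGroupBaseChange_real_of_comm H hn ⟨ψ⟩ hγ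
      ((mem_centralizer_realWeilOperator_iff H γ).1 hC)
    exact ⟨t, ht, Subgroup.mem_inf.2 ⟨hmem, mul_mem (smulOfUnit_mem_centralizer_realWeilOperator H t⁻¹) hC⟩⟩

/-! ### §2 Hodge structures of CM type and odd weight: `MT(H)(ℝ) ≅ ℝ^×_{>0} × Hg(H)(ℝ)` -/

/-- **`MT(H)(ℝ) ≅ ℝ^×_{>0} × Hg(H)(ℝ)` for EVERY polarizable Hodge structure of CM type and odd weight** (`V ≠ 0`): the
multiplication map `(t, γ₀) ↦ t · γ₀` is a group isomorphism — «`M_φ̃ = 𝔾_m · M_φ`» is, on the real points of a CM Hodge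
structure and with `𝔾_m(ℝ)_{>0}`, an honest DIRECT product (`ℝ^×_{>0} ∩ Hg(H)(ℝ) = 1`); the general form of the tree's
`nonempty_mumfordTateGroupBaseChange_real_ofCMFamily_mulEquiv_posSubgroup_prod_hodgeGroupBaseChange`.
[cite: GreenGriffithsKerr2012, §I.B (semi-direct product remark before (I.B.1)) and Ch. V (V.4)]
[cite: CarlsonMullerStachPeters2017, §15.2 Remark (ii) after Definition 15.2.1] [cite: Moonen2004MT, (5.8)]
[cite: Deligne1982HodgeCycles, I §5 (definition of CM-type) and Example 3.7 (d)] -/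
theorem nonempty_mumfordTateGroupBaseChange_real_mulEquiv_posSubgroup_prod_of_hodgeLie_le [Nontrivial V] (hn : Odd n)
    (hH : H.IsPolarizable) (hCM : H.hodgeLie ≤ Subalgebra.toSubmodule H.endAlg) :
    Nonempty (H.mumfordTateGroupBaseChange ℝ ≃* Units.posSubgroup ℝ × H.hodgeGroupBaseChange ℝ) := by
  have hn0 : n ≠ 0 := by
    rintro rfl
    exact (by decide : ¬ Odd (0 : ℤ)) hn
  obtain ⟨ψ⟩ := hH
  exact nonempty_mulEquiv_posSubgroup_prod _ _ (hodgeGroupBaseChange_le_mumfordTateGroupBaseChange ℝ H)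
    (fun t _ => H.smulOfUnit_mem_mumfordTateGroupBaseChange ℝ hn0 t)
    (fun γ hγ => exists_pos_smulOfUnit_mul_mem_hodgeGroupBaseChange_real_of_hodgeLie_le H hn ⟨ψ⟩ hCM hγ)
    fun γ _ t t' ht ht' h h' => ψ.eq_of_smulOfUnit_mul_mem_hodgeGroupBaseChange_real H ht ht' h h'

/-! ### §3 The multiplier on points: `MT(L)/Hg(L) ≅ ν(MT(L))`, `ν(MT(ℝ)) = ℝ^×_{>0}` or `ℝ^×`, CM: `MT(ℝ)/Hg(ℝ) ≅ ℝ^×_{>0}` -/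

/-- **`Hg(H)(L)` is normal in `MT(H)(L)`** (odd weight, `V ≠ 0`, `H` polarized): it is the kernel of the multiplier
character (the tree's `Polarization.hodgeGroupBaseChange_subgroupOf_eq_ker_multiplierChar`).  Stated as a theorem (use
`haveI := ψ.normal_hodgeGroupBaseChange_subgroupOf H L hn` before forming the quotient group). [cite: Moonen2004MT, (5.8)] -/
theorem Polarization.normal_hodgeGroupBaseChange_subgroupOf [Nontrivial V] (L : Type w) [Field L] [Algebra ℚ L] (hn : Odd n)
    (ψ : H.Polarization) : ((H.hodgeGroupBaseChange L).subgroupOf (H.mumfordTateGroupBaseChange L)).Normal := by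
  rw [ψ.hodgeGroupBaseChange_subgroupOf_eq_ker_multiplierChar L hn]
  infer_instance

/-- **`1 → Hg(H)(L) → MT(H)(L) → ν(MT(H)(L)) → 1`** on points, odd weight, every field `L ⊇ ℚ` (`V ≠ 0`): the multiplier induces
`MT(H)(L) / Hg(H)(L) ≅ ν(MT(H)(L)) ≤ L^×` («`Hg := Ker(MT → 𝔾_m)`», the tree's
`Polarization.hodgeGroupBaseChange_subgroupOf_eq_ker_multiplierChar`, through the first isomorphism theorem).
[cite: Moonen2004MT, (5.8)] [cite: Deligne1982HodgeCycles, I §3 proof of Prop. 3.6] -/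
theorem Polarization.nonempty_quotient_hodgeGroupBaseChange_mulEquiv_range_multiplierChar [Nontrivial V] (L : Type w) [Field L]
    [Algebra ℚ L] (hn : Odd n) (ψ : H.Polarization)
    [((H.hodgeGroupBaseChange L).subgroupOf (H.mumfordTateGroupBaseChange L)).Normal] :
    Nonempty (H.mumfordTateGroupBaseChange L ⧸ (H.hodgeGroupBaseChange L).subgroupOf (H.mumfordTateGroupBaseChange L) ≃*
      (ψ.multiplierChar L).range) :=
  ⟨(QuotientGroup.quotientMulEquivOfEq (ψ.hodgeGroupBaseChange_subgroupOf_eq_ker_multiplierChar L hn)).trans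
    (QuotientGroup.quotientKerEquivRange (ψ.multiplierChar L))⟩

/-- **`ℝ^×_{>0} ≤ ν(MT(H)(ℝ))`** in weight `≠ 0` (`V ≠ 0`): `ν(√t · id) = t` and the homotheties lie in `MT(H)(ℝ)`
(`Polarization.multiplierChar_smulOfUnit`). [cite: CarlsonMullerStachPeters2017, §15.2 Definition 15.2.2 and Examples 15.2.4 (i)]
[cite: GreenGriffithsKerr2012, §I.B (semi-direct product remark before (I.B.1))] -/
theorem Polarization.posSubgroup_le_range_multiplierChar_real [Nontrivial V] (ψ : H.Polarization) (hn : n ≠ 0) :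
    Units.posSubgroup ℝ ≤ (ψ.multiplierChar ℝ).range := by
  intro u hu
  have hu' : 0 < (u : ℝ) := (Units.mem_posSubgroup u).1 hu
  have hs : Real.sqrt u ≠ 0 := (Real.sqrt_pos.2 hu').ne'
  refine ⟨⟨LinearEquiv.smulOfUnit (Units.mk0 _ hs), H.smulOfUnit_mem_mumfordTateGroupBaseChange ℝ hn _⟩, ?_⟩
  rw [ψ.multiplierChar_smulOfUnit ℝ hn]
  exact Units.ext (by rw [Units.val_pow_eq_pow_val, Units.val_mk0, Real.sq_sqrt hu'.le])

/-- **Dichotomy: `ν(MT(H)(ℝ)) = ℝ^×_{>0}` or `ν(MT(H)(ℝ)) = ℝ^×`** (weight `≠ 0`, `V ≠ 0`): the image of the multiplier on real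
points is a subgroup of `ℝ^×` containing the index-two subgroup `ℝ^×_{>0}`. [cite: CarlsonMullerStachPeters2017, §15.2 Remark (ii) after Definition 15.2.1]
[cite: GreenGriffithsKerr2012, §I.B (semi-direct product remark before (I.B.1))] -/
theorem Polarization.range_multiplierChar_real_eq_posSubgroup_or_eq_top [Nontrivial V] (ψ : H.Polarization) (hn : n ≠ 0) :
    (ψ.multiplierChar ℝ).range = Units.posSubgroup ℝ ∨ (ψ.multiplierChar ℝ).range = ⊤ :=
  eq_posSubgroup_or_eq_top_of_le (ψ.posSubgroup_le_range_multiplierChar_real H hn)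

/-- `ν(MT(H)(ℝ)) = ℝ^×_{>0}` iff `ν > 0` on `MT(H)(ℝ)` (weight `≠ 0`, `V ≠ 0`). [cite: CarlsonMullerStachPeters2017, §15.2 Remark (ii) after Definition 15.2.1] -/
theorem Polarization.range_multiplierChar_real_eq_posSubgroup_iff [Nontrivial V] (ψ : H.Polarization) (hn : n ≠ 0) :
    (ψ.multiplierChar ℝ).range = Units.posSubgroup ℝ ↔
      ∀ γ : H.mumfordTateGroupBaseChange ℝ, 0 < (ψ.multiplierChar ℝ γ : ℝ) := by
  constructor
  · intro h γ
    exact (Units.mem_posSubgroup _).1 (h ▸ ⟨γ, rfl⟩ : ψ.multiplierChar ℝ γ ∈ Units.posSubgroup ℝ)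
  · intro h
    refine le_antisymm ?_ (ψ.posSubgroup_le_range_multiplierChar_real H hn)
    rintro u ⟨γ, rfl⟩
    exact (Units.mem_posSubgroup _).2 (h γ)

/-- **CM: `ν(MT(H)(ℝ)) = ℝ^×_{>0}`** (odd weight, `V ≠ 0`, `Lie Hg ⊆ End_Hdg`): `ν > 0` on all of `MT(H)(ℝ)` (the seat's
`Polarization.multiplierChar_pos_of_hodgeLie_le`). [cite: CarlsonMullerStachPeters2017, §15.2 Remark (ii) after Definition 15.2.1]
[cite: Deligne1982HodgeCycles, I §3 proof of Prop. 3.6 (p. 25) and §5] -/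
theorem Polarization.range_multiplierChar_real_eq_posSubgroup_of_hodgeLie_le [Nontrivial V] (ψ : H.Polarization) (hn : Odd n)
    (hCM : H.hodgeLie ≤ Subalgebra.toSubmodule H.endAlg) : (ψ.multiplierChar ℝ).range = Units.posSubgroup ℝ := by
  have hn0 : n ≠ 0 := by
    rintro rfl
    exact (by decide : ¬ Odd (0 : ℤ)) hn
  exact (ψ.range_multiplierChar_real_eq_posSubgroup_iff H hn0).2 fun γ => ψ.multiplierChar_pos_of_hodgeLie_le H hCM γ.2

/-- **CM: `MT(H)(ℝ) / Hg(H)(ℝ) ≅ ℝ^×_{>0}`** (odd weight, polarizable, `V ≠ 0`, `Lie Hg ⊆ End_Hdg`) — «`MT(h)` is isogenous to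
`SMT(h) × G_m`»: on real points of a CM Hodge structure the quotient by the (compact) Hodge group is exactly the positive reals.
[cite: CarlsonMullerStachPeters2017, §15.2 Remark (ii) after Definition 15.2.1] [cite: Moonen2004MT, (5.8)]
[cite: GreenGriffithsKerr2012, §I.B (semi-direct product remark before (I.B.1)) and Ch. V (V.4)] -/
theorem nonempty_quotient_hodgeGroupBaseChange_real_mulEquiv_posSubgroup_of_hodgeLie_le [Nontrivial V] (hn : Odd n)
    (hH : H.IsPolarizable) (hCM : H.hodgeLie ≤ Subalgebra.toSubmodule H.endAlg)
    [((H.hodgeGroupBaseChange ℝ).subgroupOf (H.mumfordTateGroupBaseChange ℝ)).Normal] :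
    Nonempty (H.mumfordTateGroupBaseChange ℝ ⧸ (H.hodgeGroupBaseChange ℝ).subgroupOf (H.mumfordTateGroupBaseChange ℝ) ≃*
      Units.posSubgroup ℝ) := by
  obtain ⟨ψ⟩ := hH
  obtain ⟨e⟩ := ψ.nonempty_quotient_hodgeGroupBaseChange_mulEquiv_range_multiplierChar H ℝ hn
  exact ⟨e.trans (MulEquiv.subgroupCongr (ψ.range_multiplierChar_real_eq_posSubgroup_of_hodgeLie_le H hn hCM))⟩

end General

/-! ### §4 The CM algebra -/

section CMAlgebra

variable {I : Type} [Fintype I] [DecidableEq I] {K : I → Type} [∀ i, Field (K i)] [∀ i, NumberField (K i)]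
  [∀ i, IsCMField (K i)] (Φ : ∀ i, CMType (K i)) [HodgeTensorFacts.{0, 0}] [Nontrivial (∀ i, K i)]

omit [∀ i, IsCMField (K i)] in
/-- **`ν(MT(⊕ᵢ V¹_{(Kᵢ,Φᵢ)})(ℝ)) = ℝ^×_{>0}`** for every polarization `ψ` of the CM algebra.
[cite: Deligne1982HodgeCycles, I Example 3.7 (d) (p. 26: the multiplier e₀)] [cite: CarlsonMullerStachPeters2017, §15.2 Remark (ii) after Definition 15.2.1] -/
theorem Polarization.range_multiplierChar_real_ofCMFamily_eq_posSubgroup (ψ : (ofCMFamily Φ).Polarization) :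
    (ψ.multiplierChar ℝ).range = Units.posSubgroup ℝ :=
  ψ.range_multiplierChar_real_eq_posSubgroup_of_hodgeLie_le (ofCMFamily Φ) odd_one (hodgeLie_ofCMFamily_le_endAlg Φ)

/-- **`MT(⊕ᵢ V¹_{(Kᵢ,Φᵢ)})(ℝ) / Hg(⊕ᵢ V¹_{(Kᵢ,Φᵢ)})(ℝ) ≅ ℝ^×_{>0}`.** [cite: Moonen2004MT, (5.8)]
[cite: GreenGriffithsKerr2012, §I.B (semi-direct product remark before (I.B.1))] [cite: Deligne1982HodgeCycles, I Example 3.7 (d) (p. 26)] -/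
theorem nonempty_quotient_hodgeGroupBaseChange_real_ofCMFamily_mulEquiv_posSubgroup
    [(((ofCMFamily Φ).hodgeGroupBaseChange ℝ).subgroupOf ((ofCMFamily Φ).mumfordTateGroupBaseChange ℝ)).Normal] :
    Nonempty ((ofCMFamily Φ).mumfordTateGroupBaseChange ℝ ⧸
        ((ofCMFamily Φ).hodgeGroupBaseChange ℝ).subgroupOf ((ofCMFamily Φ).mumfordTateGroupBaseChange ℝ) ≃*
      Units.posSubgroup ℝ) :=
  nonempty_quotient_hodgeGroupBaseChange_real_mulEquiv_posSubgroup_of_hodgeLie_le (ofCMFamily Φ) odd_one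
    (isPolarizable_ofCMFamily Φ) (hodgeLie_ofCMFamily_le_endAlg Φ)

/-- `Hg(⊕ᵢ V¹_{(Kᵢ,Φᵢ)})(ℝ)` is normal in `MT(⊕ᵢ V¹_{(Kᵢ,Φᵢ)})(ℝ)` (the instance hypothesis of the previous theorem).
[cite: Moonen2004MT, (5.8)] -/
theorem normal_hodgeGroupBaseChange_real_ofCMFamily_subgroupOf :
    (((ofCMFamily Φ).hodgeGroupBaseChange ℝ).subgroupOf ((ofCMFamily Φ).mumfordTateGroupBaseChange ℝ)).Normal := by
  obtain ⟨ψ⟩ := isPolarizable_ofCMFamily Φ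
  exact ψ.normal_hodgeGroupBaseChange_subgroupOf (ofCMFamily Φ) ℝ odd_one

end CMAlgebra

end HodgeStructure

end Literature.AlgebraicGeometry.Motives

end
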